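import Summits.QuantumFields.YangMills.Theorems.AlphaInputsT3ACv3StartLatticeKnit
import Summits.QuantumFields.YangMills.Theorems.AlphaInputsT3ACv3StartSystemSep
import HarnessLib

/-!
# `AlphaInputsT3ACv3StartSepKnit` — START v3.1 for the (FL) `hLift` binder, row (S5)-4 knit: **THE TWO REMAINING LATTICE BINDERS `hsep`∕`hsep_sh` OF `startT3_cert` DISCHARGED** from the
# generic (A4) theorem `…StartSystemSep.hsep_of_corners` — ★`hsep_canon` at the constrained non-deep plaquettes of the canonical balls (`C := (· ∈ plaqsIn 0 Ω)`, `InBall := BallBond · RbT`;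
# (hbox) by the LEAD's `hbox_canon`, the vertex row by `deep_of_vertexChart`) and its SHELL twin ★`hsep_shell` at `ShellPlaq` (`InBall := ⊥`; (hbox) by `hbox_shell`, the vertex row
# VACUOUS by the LEAD's `not_shellPlaq_of_lt`: a plaquette charted within `RtT < RbT` of an interior vertex site is not a shell plaquette) — in EXACTLY the letters and binder lists of
# `…StartLatticeKnit.hbox_canon`∕`hbox_shell` — cell `ym3-torus`, width seat `ym-ust-19936-w5` (g2)

HONEST FRAMING.  Knit only; def-free; count-neutral helper toward the (FL) row of 2′∕2′χ (`--supports stmt-QuantumFields-19936`); conclusions are literally the `hsep`∕`hsep_sh` binders of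
`…StartCert.startT3_cert` (generic `P`); (FL)∕`hLift`, the stub, the crux and the gap are NOT claimed; registry untouched.  YM₃ on T³ is RUNG R3, not Clay.

References: T. Bałaban, Commun. Math. Phys. 102 (1985) 277–309 [Balaban1985Variational] ((11)–(14) pp.279–280).
-/

set_option autoImplicit false

noncomputable section

open scoped Matrix.Norms.L2Operator

namespace Summit.QuantumFields.YangMills.Theorems.TubeStart

open Literature.MathematicalPhysics.QuantumFieldTheory.Balaban1983to89
open Literature.MathematicalPhysics.QuantumFieldTheory.Balaban1983to89.T4AdjointCovarianceUnitary (expSU)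
open Literature.MathematicalPhysics.QuantumFieldTheory.Balaban1983to89.BlockAveragingSectionAction (iterSec)
open Literature.MathematicalPhysics.QuantumFieldTheory.Balaban1983to89.B5Eq118OneStroke (iterBlockOf)
open Literature.MathematicalPhysics.QuantumFieldTheory.Balaban1983to89.B10Eq38TorusDomains (toFine plaqsIn)
open Summit.QuantumFields.Balaban3D.Carriers
open Summit.QuantumFields.YangMills.Theorems.ModelBox

variable {P : Params} {n : Type*} [Fintype n] [DecidableEq n] [Nonempty n] {k : ℕ} (Ω : Set (Site P 0)) (V : GaugeField P k (Matrix.specialUnitaryGroup n ℂ))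

/-- Rows of the canonical radii used by `hsep_of_corners`: `2·RtT + 1 ≤ L^k`, `RtT + 2 ≤ L^k`, `2·max(RtT, ⌊L^k/2⌋) + 1 ≤ N₀` (`16 ≤ L^k`, `4·L^k ≤ N₀`). [folklore] -/
theorem sep_rows (hL : 16 ≤ P.L ^ k) (hN : 4 * P.L ^ k ≤ P.sitesPerDir 0) :
    2 * RtT P k + 1 ≤ P.L ^ k ∧ RtT P k + 2 ≤ P.L ^ k ∧ 2 * max (RtT P k) (P.L ^ k / 2) + 1 ≤ P.sitesPerDir 0 := by
  refine ⟨by unfold RtT rT; omega, by unfold RtT rT; omega, ?_⟩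
  have : max (RtT P k) (P.L ^ k / 2) ≤ P.L ^ k / 2 := max_le (by unfold RtT rT; omega) le_rfl
  omega

open Classical in
/-- **★ (hsep) AT THE CANONICAL BALLS** — the binder `hsep` of `dist1_plaqHol_startSys_le`∕`startT3_cert`, from `hsep_of_corners` with (hbox) := `hbox_canon` and the vertex row discharged by
`deep_of_vertexChart` (`RbT = RtT + 1`). [cite: Balaban1985Variational, (11)–(14) pp.279–280] -/
theorem hsep_canon (hk1 : k + 1 ≤ P.m + P.K) (hsat : ∀ x x' : Site P 0, coarsen k x = coarsen k x' → (x ∈ Ω ↔ x' ∈ Ω)) (htf : ∀ z : Site P k, coarsen k (toFine k z) = z)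
    (hsat1 : ∀ z z' : Site P k, blockOf z = blockOf z' → (CellIn Ω k z ↔ CellIn Ω k z')) (lam : Plaq P k → Fin P.d) (hlam : ∀ Q j, ¬ (j = Q.μ ∨ j = Q.ν) ↔ j = lam Q)
    (hL : 16 ≤ P.L ^ k) (hN : 4 * P.L ^ k ≤ P.sitesPerDir 0) (hNk : P.sitesPerDir 0 = P.sitesPerDir k * P.L ^ k)
    (hwin : ∀ Q : Plaq P k, Q ∈ plaqsIn k Ω → ‖((wordQ k V Q : Matrix.specialUnitaryGroup n ℂ) : Matrix n n ℂ) - 1‖ ≤ 1 / 4 ∧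
      (Fintype.card n : ℝ) * ‖((wordQ k V Q : Matrix.specialUnitaryGroup n ℂ) : Matrix n n ℂ) - 1‖ < Real.pi) :
    ∀ Q Q' (q : Plaq P 0), q ∈ plaqsIn 0 Ω → ¬ Plaq.Deep (IsBallΩ k Ω) (fun v b => BallBond v (RbT P k) b) q →
      (∃ b, Plaq.HasBond q b ∧ TubeActive V (RtT P k) (FpOf k V) (tfOf k Ω) (IsTubeΩ k Ω) Q b) →
      (∃ b, Plaq.HasBond q b ∧ TubeActive V (RtT P k) (FpOf k V) (tfOf k Ω) (IsTubeΩ k Ω) Q' b) → Q = Q' := by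
  obtain ⟨hRt2, hRt, hN'⟩ := sep_rows hL hN
  have hF : ∀ Q : Plaq P k, Q ∈ plaqsIn k Ω → expSU (FpOf k V Q) = V ⟨Q.src, Q.ν⟩ * V ⟨Q.src.shift Q.ν, Q.μ⟩ * (V ⟨Q.src.shift Q.μ, Q.ν⟩)⁻¹ * (V ⟨Q.src, Q.μ⟩)⁻¹ :=
    fun Q hQ => expSU_FpOf k V Q (hwin Q hQ)
  have hbl : RtT P k + 1 ≤ RbT P k := (RtT_succ P k).le
  exact hsep_of_corners (fun Q => quadOf Ω Q) (rT P k) V (RtT P k) (FpOf k V) (IsBallΩ k Ω) (fun v b => BallBond v (RbT P k) b) (fun q => q ∈ plaqsIn 0 Ω) hk1 Ω hsat1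
    lam hlam (fun Q h => missingAhead_quadOf Ω h) (fun Q h h' => missingBehind_quadOf Ω h h') hRt2 hRt hN' hNk hF
    (hbox_canon Ω V hk1 hsat htf hsat1 lam hlam hL hN hwin)
    (fun y q _ hy hv => by obtain ⟨v, hv, hq⟩ := hv; exact deep_of_vertexChart hbl Ω hy hv hq)

open Classical in
/-- **★ (hsep) ON THE SHELL** — the binder `hsep_sh` of `startT3_cert`, from `hsep_of_corners` at `C := ShellPlaq`, `InBall := ⊥`: (hbox) := `hbox_shell`, `¬Deep` free (`not_deep_bot`), the
vertex row vacuous (`not_shellPlaq_of_lt`: vertex-chart coordinates `≤ RtT < RbT`). [cite: Balaban1985Variational, (11)–(14) pp.279–280] -/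
theorem hsep_shell (hk1 : k + 1 ≤ P.m + P.K) (hsat : ∀ x x' : Site P 0, coarsen k x = coarsen k x' → (x ∈ Ω ↔ x' ∈ Ω)) (htf : ∀ z : Site P k, coarsen k (toFine k z) = z)
    (hsat1 : ∀ z z' : Site P k, blockOf z = blockOf z' → (CellIn Ω k z ↔ CellIn Ω k z')) (hsatI : ∀ x : Site P 0, x ∈ Ω ↔ toFine k (iterBlockOf k x) ∈ Ω)
    (lam : Plaq P k → Fin P.d) (hlam : ∀ Q j, ¬ (j = Q.μ ∨ j = Q.ν) ↔ j = lam Q) (hL : 16 ≤ P.L ^ k) (hN : 4 * P.L ^ k ≤ P.sitesPerDir 0)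
    (hNk : P.sitesPerDir 0 = P.sitesPerDir k * P.L ^ k)
    (hwin : ∀ Q : Plaq P k, Q ∈ plaqsIn k Ω → ‖((wordQ k V Q : Matrix.specialUnitaryGroup n ℂ) : Matrix n n ℂ) - 1‖ ≤ 1 / 4 ∧
      (Fintype.card n : ℝ) * ‖((wordQ k V Q : Matrix.specialUnitaryGroup n ℂ) : Matrix n n ℂ) - 1‖ < Real.pi) :
    ∀ Q Q' (q : Plaq P 0), ShellPlaq k Ω q → (∃ b, Plaq.HasBond q b ∧ TubeActive V (RtT P k) (FpOf k V) (tfOf k Ω) (IsTubeΩ k Ω) Q b) →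
      (∃ b, Plaq.HasBond q b ∧ TubeActive V (RtT P k) (FpOf k V) (tfOf k Ω) (IsTubeΩ k Ω) Q' b) → Q = Q' := by
  obtain ⟨hRt2, hRt, hN'⟩ := sep_rows hL hN
  have hRL : 2 * RbT P k + 1 ≤ P.L ^ k := two_mul_RbT_add_one_le P k hL
  have hNb : 2 * RbT P k + 1 ≤ P.sitesPerDir 0 := by omega
  have hF : ∀ Q : Plaq P k, Q ∈ plaqsIn k Ω → expSU (FpOf k V Q) = V ⟨Q.src, Q.ν⟩ * V ⟨Q.src.shift Q.ν, Q.μ⟩ * (V ⟨Q.src.shift Q.μ, Q.ν⟩)⁻¹ * (V ⟨Q.src, Q.μ⟩)⁻¹ :=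
    fun Q hQ => expSU_FpOf k V Q (hwin Q hQ)
  have hlt : (RtT P k : ℤ) < RbT P k := by have := RtT_succ P k; omega
  intro Q Q' q hq hA hA'
  exact hsep_of_corners (fun Q => quadOf Ω Q) (rT P k) V (RtT P k) (FpOf k V) (IsBallΩ k Ω) (fun _ _ => False) (ShellPlaq k Ω) hk1 Ω hsat1
    lam hlam (fun Q h => missingAhead_quadOf Ω h) (fun Q h h' => missingBehind_quadOf Ω h h') hRt2 hRt hN' hNk hF
    (fun Q hQ q hq _ hact => hbox_shell Ω V hk1 hsat htf hsat1 hsatI lam hlam hL hN hNk hwin Q hQ q hq hact)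
    (fun y q hCq _ hv => by
      obtain ⟨v, hv, hsrc⟩ := hv
      exact absurd hCq (not_shellPlaq_of_lt Ω hNk hRL hNb q hsrc (fun i => lt_of_le_of_lt (hv i) hlt)))
    Q Q' q hq (not_deep_bot _ q) hA hA'

end Summit.QuantumFields.YangMills.Theorems.TubeStart

end
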